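import Literature.Probability.RandomPlanarGeometry.SAWPulledBridgeZdOrnsteinZernikeRate
import Literature.Probability.RandomPlanarGeometry.SAWPulledBridgeFreeEnergyZdLowerEnvelope
import HarnessLib

/-!
# The Ornstein–Zernike amplitude of pulled bridges on `ℤ^{d+1}`, explicitly and uniformly in the dimension:
# `1 + 2dy/(y+2d)² ≤ m(y) ≤ 1 + 23(2d+1)/y` and `|Z^B_n(y)e^{−nλ_B(y)} − 1| ≤ 23(2d+1)/y + (6/5)(12√((2d+1)/y))ⁿ`

Topic `Literature/Probability/RandomPlanarGeometry` (a corollary leaf over `SAWPulledBridgeZdOrnsteinZernikeRate.lean` — the explicit rate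
`|a_n(y) − 1/m(y)| ≤ (6/5)(12√q)ⁿ`, `q = (2d+1)/y`, and the linear tail envelope — and `SAWPulledBridgeFreeEnergyZdLowerEnvelope.lean` —
`pulledBlockLaw_two_eq : p_2 = 2d·u²/y` and the first-order envelope `y ≤ e^{λ_B} ≤ y + 2d`).

The mean block length `m(y) = Σ_i i·p_i(y)` is the reciprocal of the Ornstein–Zernike AMPLITUDE `A(y) = lim_n Z^B_n(y)e^{−nλ_B(y)}`.
Here it is located explicitly: `m(y) − 1 = p_2(y) + Σ_{k ≥ 0} (k+2)·p_{k+3}(y)` (Kesten relation), the `i = 2` block has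
`2dy/(y+2d)² ≤ p_2(y) ≤ 2d/y`, and the linear envelope `p_i ≤ √(y/(2d+1))·(2√q)^i` sums the rest to `≤ (528/25)·q` once `y ≥ 144(2d+1)`:

* `pulledMeanBlock_sub_one_eq` — `m(y) − 1 = p_2(y) + Σ_k (k+2) p_{k+3}(y)` (`y > 4(2d+1)`);
* `pulledBlockLaw_two_le_div`, `div_le_pulledBlockLaw_two` — `2dy/(y+2d)² ≤ p_2(y) ≤ 2d/y`;
* ★ **`pulledMeanBlock_mem_Icc_linear (hy : 144(2d+1) ≤ y) : m(y) ∈ [1 + 2dy/(y+2d)², 1 + 23(2d+1)/y]`** — so the amplitude is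
  `A(y) = 1/m(y) = 1 − 2d/y + O((2d+1)/y)` with explicit, dimension-uniform constants (`inv_pulledMeanBlock_mem_Icc_linear`);
* ★★ **`abs_pulledAmp_sub_one_le_linear (hy : 144(2d+1) ≤ y) (n) : |Z^B_n(y)e^{−nλ_B(y)} − 1| ≤ 23(2d+1)/y + (6/5)(12√((2d+1)/y))ⁿ`** —
  at large force pulled bridges are asymptotically free (`Z^B_n ≈ e^{nλ_B}`) with an explicit defect, uniformly in `d`.

Printed status: Madras–Slade (1993) §4.2 proves `a_n → 1/m` (renewal theorem) without locating `m`; the explicit window is, to our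
knowledge, not in print.  Provenance: lane «pcv-sawmu», a-p3 g26 (2026-08-28).  PURE STD, no data, no `decide`.
-/

noncomputable section

open Finset Filter Topology
open scoped BigOperators
open Literature.Probability.LatticeModels
open Literature.Probability.RandomPlanarGeometry.SAW

namespace Literature.Probability.RandomPlanarGeometry.SAW.Zd

/-- **The mean block length beyond its first term**: for `y > 4(2d+1)` (pulled Kesten relation and finite mean, `pulledGap_linear`),
`m(y) − 1 = p_2(y) + Σ_{k ≥ 0} (k+2)·p_{k+3}(y)` (`p_0 = 0`, the `i = 1` term cancels against `Σ_i p_i = 1`).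
[cite: MadrasSlade1993, §4.2, eq. (4.2.15)–(4.2.16) (p. 93, 2013 reprint)] -/
theorem pulledMeanBlock_sub_one_eq (d : ℕ) {y : ℝ} (hy : 4 * (2 * d + 1 : ℝ) < y) :
    pulledMeanBlock (d + 1) y - 1
      = pulledBlockLaw (d + 1) y 2 + ∑' k : ℕ, ((k : ℝ) + 2) * pulledBlockLaw (d + 1) y (k + 3) := by
  obtain ⟨hK, hM, -, -⟩ := pulledGap_linear d hy
  have hsub : Summable fun i : ℕ => ((i : ℝ) - 1) * pulledBlockLaw (d + 1) y i := by
    have := hM.sub hK.summable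
    simpa [sub_mul] using this
  have h1 : ∑' i : ℕ, ((i : ℝ) - 1) * pulledBlockLaw (d + 1) y i
      = (∑' i : ℕ, (i : ℝ) * pulledBlockLaw (d + 1) y i) - ∑' i : ℕ, pulledBlockLaw (d + 1) y i := by
    rw [← hM.tsum_sub hK.summable]
    exact tsum_congr fun i => by ring
  rw [hK.tsum_eq] at h1
  rw [pulledMeanBlock, ← h1, ← hsub.sum_add_tsum_nat_add 3]
  simp only [Finset.sum_range_succ, Finset.sum_range_zero, pulledBlockLaw_zero, Nat.cast_ofNat, Nat.cast_add, zero_add,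
    mul_zero, Nat.cast_zero, Nat.cast_one, sub_self, zero_mul, add_zero]
  congr 1
  · ring
  · refine tsum_congr fun k => ?_
    ring

/-- `p_2(y) = 2d·u(y)²/y ≤ 2d/y` (`u = y e^{−λ_B} ≤ 1`). [cite: Beaton2015, §3, Lemma 1, eq. (7)] -/
theorem pulledBlockLaw_two_le_div (d : ℕ) {y : ℝ} (hy : 0 < y) : pulledBlockLaw (d + 1) y 2 ≤ 2 * d / y := by
  rw [pulledBlockLaw_two_eq d hy]
  have hu0 := (largeForceUZd_pos d hy).le
  have hu1 := largeForceUZd_le_one d hy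
  have hsq : largeForceUZd d y ^ 2 ≤ 1 := by nlinarith
  have hd : (0 : ℝ) ≤ 2 * d := by positivity
  exact div_le_div_of_nonneg_right (by nlinarith) hy.le

/-- `2dy/(y+2d)² ≤ p_2(y)` for `y ≥ 1` (`u = y/e^{λ_B} ≥ y/(y+2d)` by the first-order envelope `e^{λ_B} ≤ y + 2d`).
[cite: Beaton2015, §3, Lemma 1, eq. (7)] -/
theorem div_le_pulledBlockLaw_two (d : ℕ) {y : ℝ} (hy : 1 ≤ y) :
    2 * d * y / (y + 2 * d) ^ 2 ≤ pulledBlockLaw (d + 1) y 2 := by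
  have hy0 : 0 < y := by linarith
  rw [pulledBlockLaw_two_eq d hy0]
  have hE := exp_pulledBridgeFreeEnergy_le_add d hy
  have hE0 : 0 < Real.exp (pulledBridgeFreeEnergy (d + 1) y) := Real.exp_pos _
  have hu : y / (y + 2 * d) ≤ largeForceUZd d y := by
    rw [largeForceUZd, Real.exp_neg, ← div_eq_mul_inv]
    exact div_le_div_of_nonneg_left hy0.le hE0 hE
  have hq0 : 0 ≤ y / (y + 2 * d) := by positivity
  have hsq : (y / (y + 2 * d)) ^ 2 ≤ largeForceUZd d y ^ 2 := by nlinarith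
  have hd : (0 : ℝ) ≤ 2 * d := by positivity
  calc 2 * d * y / (y + 2 * d) ^ 2 = 2 * d * (y / (y + 2 * d)) ^ 2 / y := by
        field_simp
    _ ≤ 2 * d * largeForceUZd d y ^ 2 / y := by
        refine div_le_div_of_nonneg_right ?_ hy0.le
        exact mul_le_mul_of_nonneg_left hsq hd

/-- **The higher blocks of the mean, summed by the linear envelope**: for `y ≥ 144(2d+1)` (so `r = 2√((2d+1)/y) ≤ 1/6`),
`0 ≤ Σ_k (k+2) p_{k+3}(y) ≤ (528/25)·(2d+1)/y` (`Σ_k (k+2)√(y/(2d+1)) r^{k+3} = 8q·(r/(1−r)² + 2/(1−r)) ≤ 8q·66/25`).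
[cite: MadrasSlade1993, Theorem 4.2.5 and Appendix B] -/
theorem tsum_pulledBlockLaw_tail_mem_Icc_linear (d : ℕ) {y : ℝ} (hy : 144 * (2 * d + 1 : ℝ) ≤ y) :
    ∑' k : ℕ, ((k : ℝ) + 2) * pulledBlockLaw (d + 1) y (k + 3) ∈ Set.Icc 0 (528 / 25 * ((2 * d + 1) / y)) := by
  have hD : (0 : ℝ) < 2 * d + 1 := by positivity
  have hy0 : 0 < y := by linarith
  have hy1 : (2 * d + 1 : ℝ) ≤ y := by linarith
  have hq0 : (0 : ℝ) ≤ (2 * d + 1) / y := by positivity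
  have hs12 : Real.sqrt ((2 * d + 1) / y) ≤ 1 / 12 := by
    have hq : (2 * d + 1) / y ≤ (1 / 12) ^ 2 := by rw [div_le_iff₀ hy0]; nlinarith
    calc Real.sqrt ((2 * d + 1) / y) ≤ Real.sqrt ((1 / 12) ^ 2) := Real.sqrt_le_sqrt hq
      _ = 1 / 12 := Real.sqrt_sq (by norm_num)
  have henv : ∀ i, pulledBlockLaw (d + 1) y i
      ≤ (Real.sqrt ((2 * d + 1) / y))⁻¹ * (2 * Real.sqrt ((2 * d + 1) / y)) ^ i :=
    fun i => pulledBlockLaw_le_geometric_linear d hy1 i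
  have hss : Real.sqrt ((2 * d + 1) / y) ^ 2 = (2 * d + 1) / y := Real.sq_sqrt hq0
  obtain ⟨s, hs0, hs12, hsq⟩ : ∃ s : ℝ, 0 < s ∧ s ≤ 1 / 12 ∧ Real.sqrt ((2 * d + 1) / y) = s :=
    ⟨_, Real.sqrt_pos.2 (by positivity), hs12, rfl⟩
  rw [hsq] at henv hss
  rw [← hss]
  obtain ⟨r, hr⟩ : ∃ r : ℝ, 2 * s = r := ⟨_, rfl⟩
  rw [hr] at henv
  have hr0 : 0 ≤ r := by rw [← hr]; positivity
  have hr6 : r ≤ 1 / 6 := by rw [← hr]; linarith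
  have hnorm : ‖r‖ < 1 := by rw [Real.norm_eq_abs, abs_of_nonneg hr0]; linarith
  have hnn : ∀ k : ℕ, 0 ≤ ((k : ℝ) + 2) * pulledBlockLaw (d + 1) y (k + 3) := fun k =>
    mul_nonneg (by positivity) (pulledBlockLaw_nonneg hy0.le _)
  -- majorant `g k = s⁻¹ r³ (k r^k + 2 r^k)`
  have hA : HasSum (fun k : ℕ => (k : ℝ) * r ^ k) (r / (1 - r) ^ 2) := hasSum_coe_mul_geometric_of_norm_lt_one hnorm
  have hB : HasSum (fun k : ℕ => r ^ k) (1 - r)⁻¹ := hasSum_geometric_of_lt_one hr0 (by linarith)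
  have hmaj : HasSum (fun k : ℕ => s⁻¹ * r ^ 3 * ((k : ℝ) * r ^ k + 2 * r ^ k))
      (s⁻¹ * r ^ 3 * (r / (1 - r) ^ 2 + 2 * (1 - r)⁻¹)) := (hA.add (hB.mul_left 2)).mul_left _
  have hle : ∀ k : ℕ, ((k : ℝ) + 2) * pulledBlockLaw (d + 1) y (k + 3) ≤ s⁻¹ * r ^ 3 * ((k : ℝ) * r ^ k + 2 * r ^ k) := by
    intro k
    calc ((k : ℝ) + 2) * pulledBlockLaw (d + 1) y (k + 3) ≤ ((k : ℝ) + 2) * (s⁻¹ * r ^ (k + 3)) :=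
          mul_le_mul_of_nonneg_left (henv (k + 3)) (by positivity)
      _ = s⁻¹ * r ^ 3 * ((k : ℝ) * r ^ k + 2 * r ^ k) := by ring
  have hsum : Summable fun k : ℕ => ((k : ℝ) + 2) * pulledBlockLaw (d + 1) y (k + 3) :=
    hmaj.summable.of_nonneg_of_le hnn hle
  refine ⟨tsum_nonneg hnn, ?_⟩
  have h1r : 5 / 6 ≤ 1 - r := by linarith
  have hfrac1 : r / (1 - r) ^ 2 ≤ 6 / 25 := by
    rw [div_le_iff₀ (by positivity)]; nlinarith
  have hfrac2 : (1 - r)⁻¹ ≤ 6 / 5 := by rw [inv_le_comm₀ (by linarith) (by norm_num)]; linarith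
  have hsr3 : s⁻¹ * r ^ 3 = 8 * s ^ 2 := by rw [← hr]; field_simp; ring
  calc ∑' k : ℕ, ((k : ℝ) + 2) * pulledBlockLaw (d + 1) y (k + 3)
      ≤ ∑' k : ℕ, s⁻¹ * r ^ 3 * ((k : ℝ) * r ^ k + 2 * r ^ k) := hsum.tsum_le_tsum hle hmaj.summable
    _ = s⁻¹ * r ^ 3 * (r / (1 - r) ^ 2 + 2 * (1 - r)⁻¹) := hmaj.tsum_eq
    _ ≤ 8 * s ^ 2 * (6 / 25 + 2 * (6 / 5)) := by
        rw [hsr3]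
        exact mul_le_mul_of_nonneg_left (by linarith) (by positivity)
    _ = 528 / 25 * s ^ 2 := by ring

/-- ★ **EXPLICIT WINDOW FOR THE MEAN BLOCK LENGTH, EVERY DIMENSION**: for every `d` and every `y ≥ 144(2d+1)`,
`1 + 2dy/(y+2d)² ≤ m(y) ≤ 1 + 23(2d+1)/y` — the reciprocal of the Ornstein–Zernike amplitude of pulled bridges is
`1 + 2d/y + O((2d+1)/y)` with dimension-uniform constants. [cite: MadrasSlade1993, §4.2, eq. (4.2.16) and Theorem 4.2.5] -/
theorem pulledMeanBlock_mem_Icc_linear (d : ℕ) {y : ℝ} (hy : 144 * (2 * d + 1 : ℝ) ≤ y) :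
    pulledMeanBlock (d + 1) y ∈ Set.Icc (1 + 2 * d * y / (y + 2 * d) ^ 2) (1 + 23 * ((2 * d + 1) / y)) := by
  have hD : (0 : ℝ) < 2 * d + 1 := by positivity
  have hy0 : 0 < y := by linarith
  have hy1 : (1 : ℝ) ≤ y := by linarith
  have hy4 : 4 * (2 * d + 1 : ℝ) < y := by linarith
  have heq := pulledMeanBlock_sub_one_eq d hy4
  obtain ⟨ht0, ht1⟩ := tsum_pulledBlockLaw_tail_mem_Icc_linear d hy
  have hp2u := pulledBlockLaw_two_le_div d hy0
  have hp2l := div_le_pulledBlockLaw_two d hy1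
  have hdq : 2 * (d : ℝ) / y ≤ (2 * d + 1) / y := div_le_div_of_nonneg_right (by linarith) hy0.le
  constructor <;> linarith

/-- The amplitude itself: `1 − 23(2d+1)/y ≤ 1/m(y) ≤ 1` for `y ≥ 144(2d+1)`, every `d`.
[cite: MadrasSlade1993, §4.2, Theorem 4.2.5] -/
theorem inv_pulledMeanBlock_mem_Icc_linear (d : ℕ) {y : ℝ} (hy : 144 * (2 * d + 1 : ℝ) ≤ y) :
    (pulledMeanBlock (d + 1) y)⁻¹ ∈ Set.Icc (1 - 23 * ((2 * d + 1) / y)) 1 := by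
  have hD : (0 : ℝ) < 2 * d + 1 := by positivity
  have hy0 : 0 < y := by linarith
  obtain ⟨hm1, hm2⟩ := pulledMeanBlock_mem_Icc_linear d hy
  have hq0 : (0 : ℝ) ≤ (2 * d + 1) / y := by positivity
  have hfrac : (0 : ℝ) ≤ 2 * d * y / (y + 2 * d) ^ 2 := by positivity
  have hm : 1 ≤ pulledMeanBlock (d + 1) y := by linarith
  have hm0 : 0 < pulledMeanBlock (d + 1) y := by linarith
  refine ⟨?_, (inv_le_one₀ hm0).2 hm⟩
  -- `1 − 23q ≤ 1/m` ⟸ `(1 − 23q)·m ≤ 1`, and `m ≤ 1 + 23q` gives `(1 − 23q)m ≤ 1 − (23q)² ≤ 1`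
  by_cases hneg : 1 - 23 * ((2 * d + 1) / y) ≤ 0
  · exact hneg.trans (inv_pos.2 hm0).le
  · push Not at hneg
    rw [← one_div, le_div_iff₀ hm0]
    nlinarith

/-- ★★ **PULLED BRIDGES AT LARGE FORCE ARE ASYMPTOTICALLY FREE, EXPLICITLY AND UNIFORMLY IN THE DIMENSION**: for every `d`,
every `y ≥ 144(2d+1)` and every `n`, `|Z^B_n(y)e^{−nλ_B(y)} − 1| ≤ 23(2d+1)/y + (6/5)·(12√((2d+1)/y))ⁿ`
(amplitude window + the explicit Ornstein–Zernike rate `abs_pulledAmp_sub_inv_le_linear`).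
[cite: MadrasSlade1993, Theorem 4.2.5 and Appendix B, (B.5)] [cite: Beaton2015, §3, Lemma 2] -/
theorem abs_pulledAmp_sub_one_le_linear (d : ℕ) {y : ℝ} (hy : 144 * (2 * d + 1 : ℝ) ≤ y) (n : ℕ) :
    |pulledAmp (d + 1) y n - 1| ≤ 23 * ((2 * d + 1) / y) + (6 / 5) * (12 * Real.sqrt ((2 * d + 1) / y)) ^ n := by
  have hrate := abs_pulledAmp_sub_inv_le_linear d hy n
  obtain ⟨hA1, hA2⟩ := inv_pulledMeanBlock_mem_Icc_linear d hy
  have htri : |pulledAmp (d + 1) y n - 1|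
      ≤ |pulledAmp (d + 1) y n - (pulledMeanBlock (d + 1) y)⁻¹| + |(pulledMeanBlock (d + 1) y)⁻¹ - 1| := by
    simpa using abs_sub_le (pulledAmp (d + 1) y n) ((pulledMeanBlock (d + 1) y)⁻¹) 1
  have hamp : |(pulledMeanBlock (d + 1) y)⁻¹ - 1| ≤ 23 * ((2 * d + 1) / y) := by
    rw [abs_sub_comm, abs_of_nonneg (by linarith)]; linarith
  linarith

end Literature.Probability.RandomPlanarGeometry.SAW.Zd
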